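/-
Copyright (c) 2026 the pub-hodgecm-mathlib formalisation cell (harness21).  Prover seat hodgecm-mathlib-K2E3-p03 (g10), Track B «K2-LIT»,
#184♮ = hLiu418 = `stmt-HodgeConjecture-24832`; socket #41 `sig_K2LiuSiegelEisensteinContinuation`, KIND W, brick (KW-fin-sup) (LEAD F0P6-plan (g15)
BATCH #217 (1), KW desk F0P2-p08 (g4)): the (B) SUP LETTER `b₁ Tβ hsup` of ★ p863720 `K2LiuKindWFiniteSizeLetterOfPlace.hsizeLoc_of_place` for the
unramified local Siegel sections `Λ_{s,v}` (the local factors of record off `S₀`, ★ p863597).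
THEOREMS ONLY (no `def`, no `instance`, no notation, no named-fact hypothesis, no `sorry`).
-/
import Summits.HodgeConjecture.HodgeConjecture.Theorems.K2LiuKindWFiniteSizeLetterOfPlace               -- ★ p863720: the slot (`kindWLocalBall`, `GLn.localHeight` currency)
import Summits.HodgeConjecture.HodgeConjecture.Theorems.K2LiuKindWFactorizationReadings                -- ★ p863597: `hread` (`FvT T₀`), `LambdaLoc`
import Summits.HodgeConjecture.HodgeConjecture.Theorems.K2LiuLocalWhittakerFactorSkew                   -- ★ `evalPlace_finPart_weylDelta`
import Summits.HodgeConjecture.HodgeConjecture.Theorems.K2LiuSiegelEisensteinDoubledSummableReduction   -- ★ `norm_siegelDeltaCharacter`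
import Literature.NumberTheory.GelbartRogawski1991.LocalDoubledUnitarySplitParabolic                    -- ★ `matW` (the adapted `w`-component)
import Literature.NumberTheory.GelbartRogawski1991.LocalDoubledWeylElementCayleyMover                   -- ★ `matA_weylDelta`
import Literature.NumberTheory.GelbartRogawski1991.DoubledUnitarySiegelPlaceComponents                  -- ★ `modDelta_locToAdelic`, `isUnit_detDelta_locToAdelic_iff`
import Literature.NumberTheory.GelbartRogawski1991.DoubledUnitarySiegelParabolicAlgebra                 -- ★ `isUnit_detDelta_of_isSiegelDelta`
import Literature.NumberTheory.Automorphic.ValuedFieldValuativeRelBridge                                -- ★ `mem_glInt_iff_forall_v_le_one`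
import Literature.NumberTheory.Automorphic.AdelicHeightGLProofs                                         -- ★ `GLn.one_le_localHeight`
import HarnessLib

/-!
# Crux `HLiu418`, socket #41, KIND W — brick (KW-fin-sup) `K2LiuKindWFiniteSectionSupBound`: THE SUP LETTER `hsup` OF ★ p863720 FOR THE LOCAL SIEGEL SECTIONS OF RECORD,
# `‖Λ_{s,v}((w_Δ)_v·y·h_v)‖ ≤ ∏_{w∣v} N𝔭_w^{β w}·H_w(h)^{k₁}` UNIFORMLY IN `y ∈ N_Δ(L⁺_v)` (FILE 1 of 2; FILE 2 = K2E3-p26 (g3) `K2LiuKindWFiniteSectionSupBoundBad`, the `S₀`-face)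

Cell `hodgecm-mathlib`, crux item hLiu418 = `stmt-HodgeConjecture-24832` (helper lane `--supports … --as helper`, count-neutral), route `HCCMUnconditional`; squad K2 ∕ K2Liu, socket #41,
KIND W; LEAD F0P6-plan (g15) BATCH #217 (1); KW desk F0P2-p08 (g4) (split (D) 01:31Z).  THE SLOT: ★ p863720 `hsizeLoc_of_place` takes BY VALUE `(b₁ : ℕ) (Tβ : Finset) (hsup : ∀ z, 0 < re z →
∃ r k₁ β, 0 < r ∧ (β = 0 off Tβ) ∧ ∀ j S s, dist s z < r → ∀ h (v : kindWFinset T₀ ↑S h) a (y ∈ kindWLocalBall v.1 (π v.1) (−a)), ‖FvT j S h v s ((w_Δ)_v·y·h_v)‖ ≤ (∏_{w∣v} N𝔭_w^{β w} H_w(h)^{k₁})·N(v)^{b₁ a})`;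
at the tie `FvT := FvT T₀` of ★ p863597 (`= Λ_{s,v}` off `S₀`, `= H_v^{2(s−s₀)}·b j v` on `S₀` — its `hread`).
FINDING 1 (the key; pure algebra, every place, every `n`).  In Kudla's adapted blocks `[[A,B],[C,D]]` (★ `AdaptedBlocks`; `P_Δ = {C = 0}`, `det_Δ = det A` on `P_Δ`, `(w_Δ)_v ↦ [[0,1],[1,0]]`,
`N_Δ ∋ y ↦ [[1,X],[0,1]]`): IF `(w_Δ)_v·y·h = p·κ` THEN **`A(p_w) = C((h·κ⁻¹)_w)`** at every `w ∣ v` — the `y`-dependence DISAPPEARS; ultrametrically `‖det C(U_w)‖_w ≤ ‖2‖_w^{−n}(max|h_w|·max|κ⁻¹_w|)^n`.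
Hence (§2) for the unramified section (`Λ_{s,v}(p k) = χ_v(det_Δ p)|det_Δ p|^{s+n∕2}`, `k ∈ K_{H,v}`): `‖Λ_{s,v}((w_Δ)_v y h_v)‖ = (∏_w ‖det_Δ p_w‖)^{re s+n∕2} ≤ ∏_{w∣v} (‖2‖_w^{−n} H_w(h)^n)^{re s+n∕2}`,
so `b₁ := 0` and `Tβ := Tb ∪ {w ∣ 2}`.  §0 ultrametric det∕entry bounds · §1 Finding 1 (`matW_mul`, `matW_weylDelta`, `blocks_matW_of_mem_unipDeltaLoc`, **`blkA_matW_eq_blkC`**, **`norm_det_blkA_matW_le`**) ·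
§2 **`norm_lambdaLoc_weylDelta_mul_le`** · §3 currency (`norm_apply_evalPlace_le_localHeight`, `exists_dyadic_exponent`, `norm_two_eq_one_of_not_mem`) and the HEAD **`hsup_of_height_of_bad`**
(hypothesis-first in the `S₀`-face letter `hbad`, frozen bytes K2/STATUS 01:36:31Z).  [Kudla1994, §3], [HarrisKudlaSweet1996, §1 (1.11)–(1.15)], [KudlaRallis1994, §2], [Casselman1980, §3],
[Shimura1997, §18.4 Prop. 18.14], [BorelJacquet1979, §1.2], [NeukirchANT1999, Ch. I §8].
HONEST LABEL.  Count-neutral helper; closes no socket by itself: `HC_CM` is proved only modulo the 7 printed citations (2 remaining named inputs: hLiu418 = `stmt-HodgeConjecture-24832`,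
h413 = `stmt-HodgeConjecture-24833`) until rung 0 closes.
-/

set_option autoImplicit false
-- the mandated namespace repeats the single-problem summit's segment (`HodgeConjecture.HodgeConjecture`)
set_option linter.dupNamespace false

noncomputable section

open scoped Matrix RestrictedProduct ENNReal NNReal Topology ComplexConjugate BigOperators
open scoped Classical
open NumberField IsDedekindDomain MeasureTheory Measure Filter Set

namespace Summit.HodgeConjecture.HodgeConjecture.Cruxes.HLiu418.K2LiuKindWFiniteSectionSupBound

open Literature.NumberTheory.Automorphic Literature.NumberTheory.GaloisRepresentations Literature.NumberTheory.LFunctions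
open Literature.NumberTheory.GelbartRogawski1991 Literature.NumberTheory.GelbartRogawski1991.GRConstruction
open Literature.NumberTheory.GelbartRogawski1991.AdaptedBlocks
open Literature.NumberTheory.GelbartRogawski1991.UnitaryDualPair Literature.NumberTheory.GelbartRogawski1991.UnitaryDualPair.LocalSplitting
open Literature.NumberTheory.K2Lit.SiegelDoubled
open Literature.NumberTheory.K2Lit.PlaceSplitting
open Literature.MeasureTheory.RestrictedProduct
open Summit.HodgeConjecture.HodgeConjecture.Cruxes.HLiu418.K2LiuSiegelUnipotentLocalDefs
open Summit.HodgeConjecture.HodgeConjecture.Cruxes.HLiu418.K2LiuSiegelUnipotentSplitDefs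
open Summit.HodgeConjecture.HodgeConjecture.Cruxes.HLiu418.K2LiuSiegelUnipotentSplitAtDefs
open Summit.HodgeConjecture.HodgeConjecture.Cruxes.HLiu418.K2LiuSiegelUnipotentFourierDefs
open Summit.HodgeConjecture.HodgeConjecture.Cruxes.HLiu418.K2LiuSiegelEisensteinKindWLetters
open Summit.HodgeConjecture.HodgeConjecture.Cruxes.HLiu418.K2LiuKindWFiniteLetterDefs (kindWLocalBall)

/-! ## §0 Ultrametric matrix bookkeeping (generic) -/

section Ultra

variable {K : Type*} [NormedField K] [IsUltrametricDist K]

/-- **`‖det A‖ ≤ R^{#m}`** when every entry of `A` has norm `≤ R` (Leibniz expansion; the sum is ultrametric, each term a product of `#m` entries times a sign). [cite: BorelJacquet1979, §1.2] -/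
theorem norm_det_le_pow_of_forall_le {m : Type*} [Fintype m] [DecidableEq m] (A : Matrix m m K) {R : ℝ} (hR : 0 ≤ R)
    (hA : ∀ i j, ‖A i j‖ ≤ R) : ‖A.det‖ ≤ R ^ Fintype.card m := by
  rw [Matrix.det_apply']
  refine IsUltrametricDist.norm_sum_le_of_forall_le_of_nonneg (pow_nonneg hR _) fun σ _ => ?_
  rw [norm_mul]
  have hsign : ‖((Equiv.Perm.sign σ : ℤ) : K)‖ ≤ 1 := by
    rcases Int.units_eq_one_or (Equiv.Perm.sign σ) with h | h <;> simp [h]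
  calc ‖((Equiv.Perm.sign σ : ℤ) : K)‖ * ‖∏ i, A (σ i) i‖ ≤ 1 * R ^ Fintype.card m := by
        refine mul_le_mul hsign ?_ (norm_nonneg _) zero_le_one
        rw [norm_prod]
        calc ∏ i, ‖A (σ i) i‖ ≤ ∏ _i : m, R := Finset.prod_le_prod (fun i _ => norm_nonneg _) fun i _ => hA _ _
          _ = R ^ Fintype.card m := by rw [Finset.prod_const, Finset.card_univ]
    _ = R ^ Fintype.card m := one_mul _

/-- entries of a product: `‖(A B)_{ij}‖ ≤ R·S` when `|A| ≤ R`, `|B| ≤ S` (ultrametric sum). [cite: BorelJacquet1979, §1.2] -/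
theorem norm_mul_apply_le {l m o : Type*} [Fintype m] (A : Matrix l m K) (B : Matrix m o K) {R S : ℝ} (hR : 0 ≤ R) (hS : 0 ≤ S)
    (hA : ∀ i j, ‖A i j‖ ≤ R) (hB : ∀ i j, ‖B i j‖ ≤ S) (i : l) (j : o) : ‖(A * B) i j‖ ≤ R * S := by
  rw [Matrix.mul_apply]
  exact IsUltrametricDist.norm_sum_le_of_forall_le_of_nonneg (mul_nonneg hR hS) fun k _ => by
    rw [norm_mul]; exact mul_le_mul (hA _ _) (hB _ _) (norm_nonneg _) hR

/-- `‖a + b − c − d‖ ≤ R` when each of the four has norm `≤ R` (ultrametric). [cite: BorelJacquet1979, §1.2] -/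
theorem norm_add_sub_sub_le {a b c d : K} {R : ℝ} (ha : ‖a‖ ≤ R) (hb : ‖b‖ ≤ R) (hc : ‖c‖ ≤ R) (hd : ‖d‖ ≤ R) : ‖a + b - c - d‖ ≤ R := by
  have h1 : ‖a + b‖ ≤ R := (IsUltrametricDist.norm_add_le_max a b).trans (max_le ha hb)
  have h2 : ‖a + b - c‖ ≤ R := by
    rw [sub_eq_add_neg]; exact (IsUltrametricDist.norm_add_le_max _ _).trans (max_le h1 (by rwa [norm_neg]))
  rw [sub_eq_add_neg]; exact (IsUltrametricDist.norm_add_le_max _ _).trans (max_le h2 (by rwa [norm_neg]))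

/-- entries of Kudla's `C`-block: `‖C(W)_{ij}‖ ≤ ‖2‖⁻¹·R` when `|W| ≤ R` (`C = ½(W₁₁ + W₁₂ − W₂₁ − W₂₂)`). [cite: Kudla1994, §3] -/
theorem norm_blkC_apply_le [Invertible (2 : K)] {ι : Type*} [Fintype ι] [DecidableEq ι] (W : Matrix (ι ⊕ ι) (ι ⊕ ι) K) {R : ℝ}
    (hW : ∀ p q, ‖W p q‖ ≤ R) (i j : ι) : ‖blkC W i j‖ ≤ ‖(2 : K)‖⁻¹ * R := by
  have h : blkC W i j = ⅟(2 : K) * (W (Sum.inl i) (Sum.inl j) + W (Sum.inl i) (Sum.inr j) - W (Sum.inr i) (Sum.inl j) - W (Sum.inr i) (Sum.inr j)) := by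
    simp only [blkC, Matrix.smul_apply, Matrix.sub_apply, Matrix.add_apply, Matrix.toBlocks₁₁, Matrix.toBlocks₁₂, Matrix.toBlocks₂₁, Matrix.toBlocks₂₂, Matrix.of_apply, smul_eq_mul]
  rw [h, norm_mul, invOf_eq_inv, norm_inv]
  exact mul_le_mul_of_nonneg_left (norm_add_sub_sub_le (hW _ _) (hW _ _) (hW _ _) (hW _ _)) (inv_nonneg.2 (norm_nonneg _))

end Ultra

/-! ## §1 Finding 1: the `Δ`-block of the Siegel part of `(w_Δ)_v · y · h` IS the `C`-block of `h · κ⁻¹` -/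

variable (L : Type) [Field L] [NumberField L] [IsCMField L]
variable {N M n : ℕ} (e : Fin N × Fin M ≃ Fin n)
  (dV : Fin N → L) (hdV : ∀ i, IsCMField.complexConj L (dV i) = dV i)
  (dW : Fin M → L) (hdW : ∀ i, IsCMField.complexConj L (dW i) = dW i)
  (v : HeightOneSpectrum (𝓞 (Fp L)))

/-- the adapted `w`-component ★ `matW` is multiplicative. [cite: Kudla1994, §3] -/
theorem matW_mul (w : UnitaryGroup.PlacesOver L v) (g h : UnitaryGroup.localPi L (IsCMField.complexConj L) (n + n) (hermD L e dV hdV dW hdW) v) :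
    matW (Fp L) L (IsCMField.complexConj L) v n w (g * h) = matW (Fp L) L (IsCMField.complexConj L) v n w g * matW (Fp L) L (IsCMField.complexConj L) v n w h := by
  simp only [matW, Matrix.reindex_apply, Subgroup.coe_mul, Pi.mul_apply, Units.val_mul, Matrix.submatrix_mul_equiv]

/-- ★ `matW w g` is the `w`-component of the adapted matrix ★ `matA g` over `L ⊗ L⁺_v`. [cite: Kudla1994, §3] -/
theorem matW_eq_matA_map (w : UnitaryGroup.PlacesOver L v) (g : UnitaryGroup.localPi L (IsCMField.complexConj L) (n + n) (hermD L e dV hdV dW hdW) v) :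
    matW (Fp L) L (IsCMField.complexConj L) v n w g = (matA (Fp L) L (IsCMField.complexConj L) v n g).map (Pi.evalRingHom (fun w : UnitaryGroup.PlacesOver L v => w.1.adicCompletion L) w) := by
  rw [matW, matA, Matrix.reindex_apply, Matrix.reindex_apply, coe_component_eq_matS_map (Fp L) L (IsCMField.complexConj L) v n g w]
  rfl

/-- **`(w_Δ)_v` in every `w`-component is `diag(1, −1)`** (★ `evalPlace_finPart_weylDelta` + ★ `matA_weylDelta`). [cite: Kudla1994, §3] -/
theorem matW_weylDelta (w : UnitaryGroup.PlacesOver L v) :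
    matW (Fp L) L (IsCMField.complexConj L) v n w (UnitaryGroup.evalPlace (Fp L) L (IsCMField.complexConj L) (n + n) (hermD L e dV hdV dW hdW) v
          (UnitaryGroup.finPart (Fp L) L (IsCMField.complexConj L) (n + n) (hermD L e dV hdV dW hdW) (Literature.NumberTheory.K2Lit.SiegelDoubled.weylDelta L e dV hdV dW hdW))) = Matrix.fromBlocks 1 0 0 (-1) := by
  rw [K2LiuLocalWhittakerFactorSkew.evalPlace_finPart_weylDelta, matW_eq_matA_map,
    matA_weylDelta (Fp L) L (IsCMField.complexConj L) v n (hermD_eq_map_gramD L e dV hdV dW hdW), Matrix.fromBlocks_map]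
  rw [Matrix.map_zero _ (map_zero _), Matrix.map_neg _ (map_neg _), Matrix.map_one _ (map_zero _) (map_one _)]

/-- the adapted blocks of `diag(1, −1)`: `A = 0`, `B = 1` (`w_Δ` swaps `Δ` and `Δ⁻`). [cite: HarrisKudlaSweet1996, §1 (1.11)] -/
theorem blkA_blkB_diag {R : Type*} [CommRing R] [Invertible (2 : R)] {ι : Type*} [Fintype ι] [DecidableEq ι] :
    blkA (Matrix.fromBlocks (1 : Matrix ι ι R) 0 0 (-1)) = 0 ∧ blkB (Matrix.fromBlocks (1 : Matrix ι ι R) 0 0 (-1)) = 1 := by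
  refine ⟨?_, ?_⟩
  · rw [blkA, Matrix.toBlocks_fromBlocks₁₁, Matrix.toBlocks_fromBlocks₁₂, Matrix.toBlocks_fromBlocks₂₁, Matrix.toBlocks_fromBlocks₂₂,
      add_zero, add_zero, add_neg_cancel, smul_zero]
  · rw [blkB, Matrix.toBlocks_fromBlocks₁₁, Matrix.toBlocks_fromBlocks₁₂, Matrix.toBlocks_fromBlocks₂₁, Matrix.toBlocks_fromBlocks₂₂,
      sub_zero, add_zero, sub_neg_eq_add, ← two_smul R (1 : Matrix ι ι R), smul_smul, invOf_mul_self, one_smul]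

set_option maxHeartbeats 400000 in
/-- **the adapted blocks of `y ∈ N_Δ(L⁺_v)` at `w`: `A = 1`, `C = 0`, `D = 1`** (★ `mem_unipDeltaLoc_iff_isUnipM`: `W₁₁ + W₁₂ = 1 = W₂₁ + W₂₂`, `W₂₂ − W₁₂ = 1`). [cite: MoeglinWaldspurger1995, I.2.1] [cite: Kudla1994, §3] -/
theorem blocks_matW_of_mem_unipDeltaLoc {y : UnitaryGroup.localPi L (IsCMField.complexConj L) (n + n) (hermD L e dV hdV dW hdW) v}
    (hy : y ∈ unipDeltaLoc L e dV hdV dW hdW v) (w : UnitaryGroup.PlacesOver L v) :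
    blkA (matW (Fp L) L (IsCMField.complexConj L) v n w y) = 1 ∧ blkC (matW (Fp L) L (IsCMField.complexConj L) v n w y) = 0 ∧ blkD (matW (Fp L) L (IsCMField.complexConj L) v n w y) = 1 := by
  obtain ⟨h1, h2, h3⟩ := (mem_unipDeltaLoc_iff_isUnipM L e dV hdV dW hdW v y).1 hy w
  have hC : blkC (matW (Fp L) L (IsCMField.complexConj L) v n w y) = 0 := (blkC_eq_zero_iff _).2 (h1.trans h2.symm)
  have hA : blkA (matW (Fp L) L (IsCMField.complexConj L) v n w y) = 1 := by rw [blkA_eq_of_blkC_eq_zero hC]; exact h1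
  refine ⟨hA, hC, ?_⟩
  have h1' : (matW (Fp L) L (IsCMField.complexConj L) v n w y).toBlocks₁₁ = 1 - (matW (Fp L) L (IsCMField.complexConj L) v n w y).toBlocks₁₂ :=
    eq_sub_of_add_eq h1
  have h2' : (matW (Fp L) L (IsCMField.complexConj L) v n w y).toBlocks₂₁ = 1 - (matW (Fp L) L (IsCMField.complexConj L) v n w y).toBlocks₂₂ :=
    eq_sub_of_add_eq h2
  have h3' : (matW (Fp L) L (IsCMField.complexConj L) v n w y).toBlocks₂₂ = 1 + (matW (Fp L) L (IsCMField.complexConj L) v n w y).toBlocks₁₂ :=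
    eq_add_of_sub_eq h3
  have h4 : (matW (Fp L) L (IsCMField.complexConj L) v n w y).toBlocks₁₁ - (matW (Fp L) L (IsCMField.complexConj L) v n w y).toBlocks₁₂ - (matW (Fp L) L (IsCMField.complexConj L) v n w y).toBlocks₂₁ + (matW (Fp L) L (IsCMField.complexConj L) v n w y).toBlocks₂₂ = 1 + 1 := by
    rw [h1', h2', h3']; abel
  rw [blkD, h4, ← two_smul (w.1.adicCompletion L) (1 : Matrix (Fin n) (Fin n) (w.1.adicCompletion L)), smul_smul, invOf_mul_self, one_smul]

set_option maxHeartbeats 800000 in -- MEASURED: 400 000 ✗ (`whnf`∕`isDefEq` of the `↥(localPi …)` group law behind `matW_mul` ∕ `hp`; ★ p863154 ∕ p863720's class) ∕ 800 000 ✓; scoped to this decl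
/-- **FINDING 1 (the key identity).**  If `(w_Δ)_v · y · h = p · κ` in `H(L⁺_v)` with `y ∈ N_Δ(L⁺_v)`, then at every `w ∣ v` Kudla's `Δ`-block of `p_w` is the `C`-block of
`(h κ⁻¹)_w`: `A(p_w) = C((h·κ⁻¹)_w)` — because `p = (w_Δ)_v · y · (h κ⁻¹)` and `[[0,1],[1,0]]·[[1,X],[0,1]]·U = [[U₂₁, U₂₂], [⋯]]`.  The `y`-dependence is gone. [cite: Kudla1994, §3] [cite: HarrisKudlaSweet1996, §1 (1.11)] [cite: KudlaRallis1994, §2] -/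
theorem blkA_matW_eq_blkC {y : UnitaryGroup.localPi L (IsCMField.complexConj L) (n + n) (hermD L e dV hdV dW hdW) v}
    (hy : y ∈ unipDeltaLoc L e dV hdV dW hdW v) {p κ h : UnitaryGroup.localPi L (IsCMField.complexConj L) (n + n) (hermD L e dV hdV dW hdW) v}
    (hpk : UnitaryGroup.evalPlace (Fp L) L (IsCMField.complexConj L) (n + n) (hermD L e dV hdV dW hdW) v (UnitaryGroup.finPart (Fp L) L (IsCMField.complexConj L) (n + n) (hermD L e dV hdV dW hdW) (Literature.NumberTheory.K2Lit.SiegelDoubled.weylDelta L e dV hdV dW hdW)) * y * h = p * κ)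
    (w : UnitaryGroup.PlacesOver L v) :
    blkA (matW (Fp L) L (IsCMField.complexConj L) v n w p) = blkC (matW (Fp L) L (IsCMField.complexConj L) v n w (h * κ⁻¹)) := by
  have hp : p = UnitaryGroup.evalPlace (Fp L) L (IsCMField.complexConj L) (n + n) (hermD L e dV hdV dW hdW) v (UnitaryGroup.finPart (Fp L) L (IsCMField.complexConj L) (n + n) (hermD L e dV hdV dW hdW) (Literature.NumberTheory.K2Lit.SiegelDoubled.weylDelta L e dV hdV dW hdW)) * y * (h * κ⁻¹) :=
    (eq_mul_inv_of_mul_eq hpk.symm).trans (mul_assoc _ _ _)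
  obtain ⟨hAy, hCy, hDy⟩ := blocks_matW_of_mem_unipDeltaLoc L e dV hdV dW hdW v hy w
  have hAw : blkA (matW (Fp L) L (IsCMField.complexConj L) v n w (UnitaryGroup.evalPlace (Fp L) L (IsCMField.complexConj L) (n + n) (hermD L e dV hdV dW hdW) v
      (UnitaryGroup.finPart (Fp L) L (IsCMField.complexConj L) (n + n) (hermD L e dV hdV dW hdW) (Literature.NumberTheory.K2Lit.SiegelDoubled.weylDelta L e dV hdV dW hdW)))) = 0 := by
    rw [matW_weylDelta]; exact (blkA_blkB_diag (R := w.1.adicCompletion L) (ι := Fin n)).1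
  have hBw : blkB (matW (Fp L) L (IsCMField.complexConj L) v n w (UnitaryGroup.evalPlace (Fp L) L (IsCMField.complexConj L) (n + n) (hermD L e dV hdV dW hdW) v
      (UnitaryGroup.finPart (Fp L) L (IsCMField.complexConj L) (n + n) (hermD L e dV hdV dW hdW) (Literature.NumberTheory.K2Lit.SiegelDoubled.weylDelta L e dV hdV dW hdW)))) = 1 := by
    rw [matW_weylDelta]; exact (blkA_blkB_diag (R := w.1.adicCompletion L) (ι := Fin n)).2
  have e1 : matW (Fp L) L (IsCMField.complexConj L) v n w (UnitaryGroup.evalPlace (Fp L) L (IsCMField.complexConj L) (n + n) (hermD L e dV hdV dW hdW) v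
      (UnitaryGroup.finPart (Fp L) L (IsCMField.complexConj L) (n + n) (hermD L e dV hdV dW hdW) (Literature.NumberTheory.K2Lit.SiegelDoubled.weylDelta L e dV hdV dW hdW)) * y * (h * κ⁻¹)) =
      matW (Fp L) L (IsCMField.complexConj L) v n w (UnitaryGroup.evalPlace (Fp L) L (IsCMField.complexConj L) (n + n) (hermD L e dV hdV dW hdW) v (UnitaryGroup.finPart (Fp L) L (IsCMField.complexConj L) (n + n) (hermD L e dV hdV dW hdW) (Literature.NumberTheory.K2Lit.SiegelDoubled.weylDelta L e dV hdV dW hdW))) *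
      matW (Fp L) L (IsCMField.complexConj L) v n w y * matW (Fp L) L (IsCMField.complexConj L) v n w (h * κ⁻¹) := by
    rw [matW_mul, matW_mul]
  rw [hp, e1, blkA_mul, blkA_mul, blkB_mul, hAw, hBw, hAy, hCy, hDy]
  simp only [zero_mul, one_mul, zero_add, add_zero]

set_option maxHeartbeats 800000 in -- MEASURED: 200 000 borderline (✓ then ✗ on two farm runs: the `κ⁻¹`-coercion block in the statement; ★ p863720's class) ∕ 400 000 ✓; 800 000 = margin; scoped to this decl
/-- **FINDING 1, quantitative.**  With `(w_Δ)_v · y · h = p · κ`, `y ∈ N_Δ(L⁺_v)`, and entry bounds `|h_w| ≤ R_h`, `|(κ⁻¹)_w| ≤ R_κ` at a place `w ∣ v`: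
`‖det A(p_w)‖_w ≤ (‖2‖_w⁻¹ · R_h · R_κ)^n` — uniformly in `y`. [cite: Kudla1994, §3] [cite: KudlaRallis1994, §2] [cite: BorelJacquet1979, §1.2] -/
theorem norm_det_blkA_matW_le {y : UnitaryGroup.localPi L (IsCMField.complexConj L) (n + n) (hermD L e dV hdV dW hdW) v}
    (hy : y ∈ unipDeltaLoc L e dV hdV dW hdW v) {p κ h : UnitaryGroup.localPi L (IsCMField.complexConj L) (n + n) (hermD L e dV hdV dW hdW) v}
    (hpk : UnitaryGroup.evalPlace (Fp L) L (IsCMField.complexConj L) (n + n) (hermD L e dV hdV dW hdW) v (UnitaryGroup.finPart (Fp L) L (IsCMField.complexConj L) (n + n) (hermD L e dV hdV dW hdW) (Literature.NumberTheory.K2Lit.SiegelDoubled.weylDelta L e dV hdV dW hdW)) * y * h = p * κ)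
    (w : UnitaryGroup.PlacesOver L v) {Rh Rκ : ℝ} (hRh : 0 ≤ Rh) (hRκ : 0 ≤ Rκ)
    (hh : ∀ a b, ‖(((h : UnitaryGroup.LocalGLPi L (n + n) v) w : GL (Fin (n + n)) (w.1.adicCompletion L)) : Matrix (Fin (n + n)) (Fin (n + n)) (w.1.adicCompletion L)) a b‖ ≤ Rh)
    (hκ : ∀ a b, ‖((((κ⁻¹ : UnitaryGroup.localPi L (IsCMField.complexConj L) (n + n) (hermD L e dV hdV dW hdW) v) : UnitaryGroup.LocalGLPi L (n + n) v) w : GL (Fin (n + n)) (w.1.adicCompletion L)) : Matrix (Fin (n + n)) (Fin (n + n)) (w.1.adicCompletion L)) a b‖ ≤ Rκ) :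
    ‖(blkA (matW (Fp L) L (IsCMField.complexConj L) v n w p)).det‖ ≤ (‖(2 : w.1.adicCompletion L)‖⁻¹ * (Rh * Rκ)) ^ n := by
  rw [blkA_matW_eq_blkC L e dV hdV dW hdW v hy hpk w, matW_mul]
  have hent : ∀ p q, ‖(matW (Fp L) L (IsCMField.complexConj L) v n w h * matW (Fp L) L (IsCMField.complexConj L) v n w κ⁻¹) p q‖ ≤ Rh * Rκ :=
    norm_mul_apply_le _ _ hRh hRκ (fun _ _ => hh _ _) (fun _ _ => hκ _ _)
  have h := norm_det_le_pow_of_forall_le (blkC (matW (Fp L) L (IsCMField.complexConj L) v n w h * matW (Fp L) L (IsCMField.complexConj L) v n w κ⁻¹))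
    (mul_nonneg (inv_nonneg.2 (norm_nonneg _)) (mul_nonneg hRh hRκ)) (fun i j => norm_blkC_apply_le _ hent i j)
  rwa [Fintype.card_fin] at h

/-! ## §2 Finding 2: the sup bound for the unramified local Siegel section `Λ_{s,v}` at one place, in entry currency -/

/-- entries of an element of `K_{H,v} = H(𝒪_v)` have norm `≤ 1` at every `w ∣ v` (★ `mem_localInt_iff`, ★ `mem_glInt_iff_forall_v_le_one`). [cite: BorelJacquet1979, §1.2] -/
theorem norm_apply_le_one_of_mem_localInt {k : UnitaryGroup.localPi L (IsCMField.complexConj L) (n + n) (hermD L e dV hdV dW hdW) v}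
    (hk : k ∈ UnitaryGroup.localInt L (IsCMField.complexConj L) (n + n) (hermD L e dV hdV dW hdW) v) (w : UnitaryGroup.PlacesOver L v) (a b : Fin (n + n)) :
    ‖(((k : UnitaryGroup.LocalGLPi L (n + n) v) w : GL (Fin (n + n)) (w.1.adicCompletion L)) : Matrix (Fin (n + n)) (Fin (n + n)) (w.1.adicCompletion L)) a b‖ ≤ 1 := by
  have hw := (UnitaryGroup.mem_localInt_iff L (IsCMField.complexConj L) (n + n) (hermD L e dV hdV dW hdW) v k).1 hk w
  exact Valued.toNormedField.norm_le_one_iff.2 (((mem_glInt_iff_forall_v_le_one _).1 hw).1 a b)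

/-- `det_Δ(p_w) = det A(p_w)` for `p ∈ P_Δ(L⁺_v)` (★ `detDeltaM`, Kudla's `A = ½(p₁₁+p₁₂+p₂₁+p₂₂) = p₁₁+p₁₂` when `C = 0`). [cite: Kudla1994, §3] [cite: HarrisKudlaSweet1996, §1 (1.15)] -/
theorem detDeltaM_eq_det_blkA {p : UnitaryGroup.localPi L (IsCMField.complexConj L) (n + n) (hermD L e dV hdV dW hdW) v}
    (hp : p ∈ siegelDeltaLoc L e dV hdV dW hdW v) (w : UnitaryGroup.PlacesOver L v) :
    detDeltaM ((((p : UnitaryGroup.LocalGLPi L (n + n) v) w : GL (Fin (n + n)) (w.1.adicCompletion L)) : Matrix (Fin (n + n)) (Fin (n + n)) (w.1.adicCompletion L))) = (blkA (matW (Fp L) L (IsCMField.complexConj L) v n w p)).det := by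
  have hSM := (mem_siegelDeltaLoc_iff_isSiegelM L e dV hdV dW hdW v p).1 hp w
  have hC : blkC (matW (Fp L) L (IsCMField.complexConj L) v n w p) = 0 := (blkC_eq_zero_iff _).2 hSM
  rw [blkA_eq_of_blkC_eq_zero hC]
  rfl

set_option maxHeartbeats 800000 in -- MEASURED: 200 000 ✗ ∕ 400 000 ✓ (`whnf` behind `rw [hpk]` ∕ the `↥(localPi …)` decomposition terms; ★ p863720's class); 800 000 = one doubling of margin (the farm count fluctuated by a few % between runs); scoped to this decl
/-- **FINDING 2: THE SUP BOUND FOR `Λ_{s,v}`, UNIFORM IN `y ∈ N_Δ(L⁺_v)`.**  For `χ` unitary and unramified above `v`, `0 ≤ 2 re s + n ≤ 2k`, `y ∈ N_Δ(L⁺_v)`, and any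
`h ∈ H(L⁺_v)` whose `w`-components have entries of norm `≤ R w` (`1 ≤ R w`): `‖Λ_{s,v}((w_Δ)_v · y · h)‖ ≤ ∏_{w∣v} (‖2‖_w⁻¹ · R w)^{n k}`.
Proof: either `(w_Δ)_v y h ∉ P_Δ·K_{H,v}` (`Λ = 0`, ★ `lambdaLoc_eq_zero`) or `= p k` with `k ∈ K_{H,v}`: `Λ = χ(det_Δ ι_v p)·modDelta(ι_v p)^{2s+n}` (★ `lambdaLoc_mul_eq`), norm
`= (∏_w √‖det_Δ p_w‖)^{2 re s + n}` (★ `norm_siegelDeltaCharacter`, ★ `modDelta_locToAdelic`) and `‖det_Δ p_w‖ = ‖det A(p_w)‖ ≤ (‖2‖_w⁻¹ R)^n` by Finding 1 (`κ := k`, `|k⁻¹| ≤ 1`). [cite: KudlaRallis1994, §2] [cite: Casselman1980, §3] [cite: HarrisKudlaSweet1996, §1 (1.15)] [cite: Shimura1997, §18.4 Prop. 18.14] -/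
theorem norm_lambdaLoc_weylDelta_mul_le {χ : HeckeCharacter L} (hχu : χ.IsUnitary) (hχv : ∀ w : UnitaryGroup.PlacesOver L v, χ.IsUnramifiedAt w.1)
    {s : ℂ} (hs : 0 ≤ 2 * s.re + n) {k : ℕ} (hk : 2 * s.re + n ≤ 2 * k)
    {y : UnitaryGroup.localPi L (IsCMField.complexConj L) (n + n) (hermD L e dV hdV dW hdW) v} (hy : y ∈ unipDeltaLoc L e dV hdV dW hdW v)
    (h : UnitaryGroup.localPi L (IsCMField.complexConj L) (n + n) (hermD L e dV hdV dW hdW) v) {R : UnitaryGroup.PlacesOver L v → ℝ} (hR : ∀ w, 1 ≤ R w)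
    (hh : ∀ (w : UnitaryGroup.PlacesOver L v) (a b : Fin (n + n)), ‖(((h : UnitaryGroup.LocalGLPi L (n + n) v) w : GL (Fin (n + n)) (w.1.adicCompletion L)) : Matrix (Fin (n + n)) (Fin (n + n)) (w.1.adicCompletion L)) a b‖ ≤ R w) :
    ‖LambdaLoc L e dV hdV dW hdW v χ s (UnitaryGroup.evalPlace (Fp L) L (IsCMField.complexConj L) (n + n) (hermD L e dV hdV dW hdW) v (UnitaryGroup.finPart (Fp L) L (IsCMField.complexConj L) (n + n) (hermD L e dV hdV dW hdW) (Literature.NumberTheory.K2Lit.SiegelDoubled.weylDelta L e dV hdV dW hdW)) * y * h)‖ ≤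
      ∏ w : UnitaryGroup.PlacesOver L v, (‖(2 : w.1.adicCompletion L)‖⁻¹ * R w) ^ (n * k) := by
  have hR0 : ∀ w, 0 ≤ R w := fun w => zero_le_one.trans (hR w)
  -- the base at `w`: `B_w := (‖2‖_w⁻¹ R)^n ≥ 1`
  have h2 : ∀ w : UnitaryGroup.PlacesOver L v, 1 ≤ ‖(2 : w.1.adicCompletion L)‖⁻¹ := fun w => by
    have h2le : ‖(2 : w.1.adicCompletion L)‖ ≤ 1 := by
      have h := NumberField.FinitePlace.norm_le_one (K := L) (v := w.1) (2 : 𝓞 L)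
      simpa only [map_ofNat] using h
    have h2ne : ‖(2 : w.1.adicCompletion L)‖ ≠ 0 := norm_ne_zero_iff.2 two_ne_zero
    exact one_le_inv_iff₀.2 ⟨lt_of_le_of_ne (norm_nonneg _) (Ne.symm h2ne), h2le⟩
  have hB1 : ∀ w : UnitaryGroup.PlacesOver L v, 1 ≤ ‖(2 : w.1.adicCompletion L)‖⁻¹ * R w := fun w => one_le_mul_of_one_le_of_one_le (h2 w) (hR w)
  by_cases hdec : ∃ pk, IsSiegelIntDecomp L e dV hdV dW hdW v (UnitaryGroup.evalPlace (Fp L) L (IsCMField.complexConj L) (n + n) (hermD L e dV hdV dW hdW) v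
        (UnitaryGroup.finPart (Fp L) L (IsCMField.complexConj L) (n + n) (hermD L e dV hdV dW hdW) (Literature.NumberTheory.K2Lit.SiegelDoubled.weylDelta L e dV hdV dW hdW)) * y * h) pk
  · obtain ⟨⟨p, κ⟩, hp, hκ, hpk⟩ := hdec
    rw [hpk, lambdaLoc_mul_eq L e dV hdV dW hdW v χ s hχv hp hκ, siegelCharLoc_apply,
      K2LiuSiegelEisensteinDoubledSummableReduction.norm_siegelDeltaCharacter L e dV hdV dW hdW hχu s]
    have hunit := (isUnit_detDelta_locToAdelic_iff L e dV hdV dW hdW v p).1 (isUnit_detDelta_of_isSiegelDelta L e dV hdV dW hdW _ hp)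
    rw [modDelta_locToAdelic L e dV hdV dW hdW v p hunit]
    -- per-place bound by Finding 1 (`κ⁻¹ ∈ K_{H,v}` has entries of norm ≤ 1)
    have hκ' : ∀ (w : UnitaryGroup.PlacesOver L v) (a b : Fin (n + n)), ‖((((κ⁻¹ : UnitaryGroup.localPi L (IsCMField.complexConj L) (n + n) (hermD L e dV hdV dW hdW) v) : UnitaryGroup.LocalGLPi L (n + n) v) w : GL (Fin (n + n)) (w.1.adicCompletion L)) : Matrix (Fin (n + n)) (Fin (n + n)) (w.1.adicCompletion L)) a b‖ ≤ 1 :=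
      fun w a b => norm_apply_le_one_of_mem_localInt L e dV hdV dW hdW v (inv_mem hκ) w a b
    have hdet : ∀ w : UnitaryGroup.PlacesOver L v, ‖detDeltaM ((((p : UnitaryGroup.LocalGLPi L (n + n) v) w : GL (Fin (n + n)) (w.1.adicCompletion L)) : Matrix (Fin (n + n)) (Fin (n + n)) (w.1.adicCompletion L)))‖ ≤ (‖(2 : w.1.adicCompletion L)‖⁻¹ * R w) ^ n := fun w => by
      rw [detDeltaM_eq_det_blkA L e dV hdV dW hdW v hp w]
      have := norm_det_blkA_matW_le L e dV hdV dW hdW v hy hpk w (hR0 w) zero_le_one (hh w) (hκ' w)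
      rwa [mul_one] at this
    -- assemble: `(∏ √a_w)^{2 re s + n} ≤ ∏ B_w^k`
    have ha0 : ∀ w : UnitaryGroup.PlacesOver L v, 0 ≤ Real.sqrt ‖detDeltaM ((((p : UnitaryGroup.LocalGLPi L (n + n) v) w : GL (Fin (n + n)) (w.1.adicCompletion L)) : Matrix (Fin (n + n)) (Fin (n + n)) (w.1.adicCompletion L)))‖ := fun w => Real.sqrt_nonneg _
    calc (∏ w : UnitaryGroup.PlacesOver L v, Real.sqrt ‖detDeltaM ((((p : UnitaryGroup.LocalGLPi L (n + n) v) w : GL (Fin (n + n)) (w.1.adicCompletion L)) :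
            Matrix (Fin (n + n)) (Fin (n + n)) (w.1.adicCompletion L)))‖) ^ (2 * s.re + (n : ℝ)) ≤ (∏ w : UnitaryGroup.PlacesOver L v, Real.sqrt ((‖(2 : w.1.adicCompletion L)‖⁻¹ * R w) ^ n)) ^ (2 * s.re + (n : ℝ)) := by
          refine Real.rpow_le_rpow (Finset.prod_nonneg fun w _ => ha0 w) (Finset.prod_le_prod (fun w _ => ha0 w) fun w _ => Real.sqrt_le_sqrt (hdet w)) hs
      _ = ∏ w : UnitaryGroup.PlacesOver L v, ((‖(2 : w.1.adicCompletion L)‖⁻¹ * R w) ^ n) ^ ((2 * s.re + (n : ℝ)) / 2) := by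
          rw [← Real.finsetProd_rpow _ _ (fun w _ => Real.sqrt_nonneg _)]
          refine Finset.prod_congr rfl fun w _ => ?_
          rw [Real.sqrt_eq_rpow, ← Real.rpow_mul (pow_nonneg (zero_le_one.trans (hB1 w)) n)]
          congr 1; ring
      _ ≤ ∏ w : UnitaryGroup.PlacesOver L v, (‖(2 : w.1.adicCompletion L)‖⁻¹ * R w) ^ (n * k) := by
          refine Finset.prod_le_prod (fun w _ => Real.rpow_nonneg (pow_nonneg (zero_le_one.trans (hB1 w)) n) _) fun w _ => ?_
          calc ((‖(2 : w.1.adicCompletion L)‖⁻¹ * R w) ^ n) ^ ((2 * s.re + (n : ℝ)) / 2) ≤ ((‖(2 : w.1.adicCompletion L)‖⁻¹ * R w) ^ n) ^ (k : ℝ) := Real.rpow_le_rpow_of_exponent_le (one_le_pow₀ (hB1 w)) (by linarith)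
            _ = (‖(2 : w.1.adicCompletion L)‖⁻¹ * R w) ^ (n * k) := by rw [Real.rpow_natCast, pow_mul]
  · rw [lambdaLoc_eq_zero L e dV hdV dW hdW v χ s hdec, norm_zero]
    exact Finset.prod_nonneg fun w _ => pow_nonneg (zero_le_one.trans (hB1 w)) _

/-! ## §3 The currency of the slot (`H_w(h)`, `N𝔭_w^{β w}`) and the head -/

/-- **entries against the local height**: the `w`-component of `h_v = evalPlace v (finPart h)` has entries of norm `≤ H_w(h)` (★ `GLn.localHeight`, the sup of the entry norms
of `h_w` and `h_w⁻¹`; ★ `map_adeleEval_eq_evalPlace`). [cite: BorelJacquet1979, §1.2] -/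
theorem norm_apply_evalPlace_le_localHeight {v : HeightOneSpectrum (𝓞 (Fp L))} (h : HA L e dV hdV dW hdW) (w : UnitaryGroup.PlacesOver L v) (a b : Fin (n + n)) :
    ‖((((UnitaryGroup.evalPlace (Fp L) L (IsCMField.complexConj L) (n + n) (hermD L e dV hdV dW hdW) v (UnitaryGroup.finPart (Fp L) L (IsCMField.complexConj L) (n + n) (hermD L e dV hdV dW hdW) h) : UnitaryGroup.localPi L (IsCMField.complexConj L) (n + n) (hermD L e dV hdV dW hdW) v) : UnitaryGroup.LocalGLPi L (n + n) v) w :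
        GL (Fin (n + n)) (w.1.adicCompletion L)) : Matrix (Fin (n + n)) (Fin (n + n)) (w.1.adicCompletion L)) a b‖ ≤ (GLn.localHeight (n + n) L w.1 (h : GL (Fin (n + n)) (AdeleRing (𝓞 L) L)) : ℝ) := by
  have hm := congrFun (congrFun (K2LiuSiegelUnipotentCharacterFactorisation.map_adeleEval_eq_evalPlace L e dV hdV dW hdW v h w) a) b
  have h1 := Finset.le_sup (f := fun ij : Fin (n + n) × Fin (n + n) => ‖(Matrix.GeneralLinearGroup.map (AdelicGroupData.adeleEval L w.1) (h : GL (Fin (n + n)) (AdeleRing (𝓞 L) L)) :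
          Matrix (Fin (n + n)) (Fin (n + n)) (w.1.adicCompletion L)) ij.1 ij.2‖₊ ⊔ ‖(((Matrix.GeneralLinearGroup.map (AdelicGroupData.adeleEval L w.1) (h : GL (Fin (n + n)) (AdeleRing (𝓞 L) L)))⁻¹ :
          GL (Fin (n + n)) (w.1.adicCompletion L)) : Matrix (Fin (n + n)) (Fin (n + n)) (w.1.adicCompletion L)) ij.1 ij.2‖₊) (Finset.mem_univ (a, b))
  dsimp only at h1
  rw [Matrix.GeneralLinearGroup.map_apply] at h1
  have h2 : (‖AdelicGroupData.adeleEval L w.1 (((h : HA L e dV hdV dW hdW) : GL (Fin (n + n)) (AdeleRing (𝓞 L) L)) a b)‖₊ : ℝ) ≤ (GLn.localHeight (n + n) L w.1 (h : GL (Fin (n + n)) (AdeleRing (𝓞 L) L)) : ℝ) := NNReal.coe_le_coe.2 (le_trans le_sup_left h1)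
  rw [coe_nnnorm] at h2
  rw [← hm, Matrix.map_apply]
  exact h2

/-- per-place currency: `(c·H)^e ≤ N^β·H^{k₁}` when `0 ≤ c ≤ N^t`, `1 ≤ N`, `1 ≤ H`, `t·e ≤ β`, `e ≤ k₁`. [cite: Shimura1997, §18.4 Prop. 18.14] -/
theorem mul_pow_le_pow_mul_pow {N' H c : ℝ} (hN : 1 ≤ N') (hH : 1 ≤ H) {t e' β k₁ : ℕ} (hc : 0 ≤ c) (hct : c ≤ N' ^ t) (hβ : t * e' ≤ β) (hk : e' ≤ k₁) :
    (c * H) ^ e' ≤ N' ^ β * H ^ k₁ := by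
  rw [mul_pow]
  calc c ^ e' * H ^ e' ≤ (N' ^ t) ^ e' * H ^ k₁ :=
        mul_le_mul (pow_le_pow_left₀ hc hct _) (pow_le_pow_right₀ hH hk) (pow_nonneg (zero_le_one.trans hH) _) (pow_nonneg (pow_nonneg (zero_le_one.trans hN) _) _)
    _ ≤ N' ^ β * H ^ k₁ := by
        rw [← pow_mul]
        exact mul_le_mul_of_nonneg_right (pow_le_pow_right₀ hN hβ) (pow_nonneg (zero_le_one.trans hH) _)

omit [IsCMField L] in
/-- **the dyadic exponents**: for every place `w` of `L` there is `t : ℕ` with `‖2‖_w⁻¹ ≤ N𝔭_w^t`, and `t = 0` where `‖2‖_w = 1` (off the finitely many `w ∣ 2`). [cite: NeukirchANT1999, Ch. II §4] -/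
theorem exists_dyadic_exponent (w : HeightOneSpectrum (𝓞 L)) :
    ∃ t : ℕ, ‖(2 : w.adicCompletion L)‖⁻¹ ≤ ((Ideal.absNorm w.asIdeal : ℕ) : ℝ) ^ t ∧ (‖(2 : w.adicCompletion L)‖ = 1 → t = 0) := by
  by_cases h1 : ‖(2 : w.adicCompletion L)‖ = 1
  · exact ⟨0, by rw [h1, inv_one, pow_zero], fun _ => rfl⟩
  · have hN : (1 : ℝ) < ((Ideal.absNorm w.asIdeal : ℕ) : ℝ) := by exact_mod_cast NumberField.HeightOneSpectrum.one_lt_absNorm w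
    obtain ⟨t, ht⟩ := pow_unbounded_of_one_lt ‖(2 : w.adicCompletion L)‖⁻¹ hN
    exact ⟨t, ht.le, fun h => absurd h h1⟩

omit [IsCMField L] in
/-- the places of `L` above `2` form a finite set, off which `‖2‖_w = 1` (★ Mathlib `Ideal.finite_factors`, `FinitePlace.norm_eq_one_iff_notMem`). [cite: NeukirchANT1999, Ch. I §8] -/
theorem norm_two_eq_one_of_not_mem {w : HeightOneSpectrum (𝓞 L)}
    (hw : w ∉ (Ideal.finite_factors (I := Ideal.span {(2 : 𝓞 L)}) (by simp)).toFinset) : ‖(2 : w.adicCompletion L)‖ = 1 := by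
  have h2 : (2 : 𝓞 L) ∉ w.asIdeal := by
    intro hmem
    exact hw ((Set.Finite.mem_toFinset _).2 (Ideal.dvd_span_singleton.2 hmem))
  have h := (NumberField.FinitePlace.norm_eq_one_iff_notMem (K := L) (v := w) (2 : 𝓞 L)).2 h2
  simpa only [map_ofNat] using h

set_option maxHeartbeats 800000 in -- MEASURED: 400 000 ✗ (`whnf` of the ★ p863720-class statement: the dependent `FvT` ∕ `kindWLocalBall` ∕ `hbad` binder blocks) ∕ 800 000 ✓; scoped to the head
/-- **THE SUP LETTER `hsup` OF ★ p863720, HYPOTHESIS-FIRST IN THE `S₀`-FACE `hbad` (FILE 1 HEAD).**  INPUT (all BY VALUE): the bad set `S₀` with `χ` unitary and unramified off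
`S₀`; the (KW-fac) READING `hread` of the local factors `FvT` (★ p863597 :206–:211 at this `T₀`: `Λ_{s,v}` off `S₀`, the flat twists `H_v^{2(s−s₀)}·b j v` on `S₀`); any uniformisers `π`;
and the `S₀`-FACE letter `hbad` (the same sup bound at the finitely many `v ∈ S₀`, uniform in `y`, exponents supported on `Tb` — FILE 2 `K2LiuKindWFiniteSectionSupBoundBad.hbad_of_std`,
K2E3-p26 (g3)).  OUTPUT: `∃ b₁ Tβ, ‹★ p863720 :243–:254 VERBATIM›` with `b₁ := 0` (the bound is UNIFORM in `y ∈ N_Δ(L⁺_v)`: the ball is never used) and `Tβ := Tb ∪ {w ∣ 2}`.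
Off `S₀`: §2 `norm_lambdaLoc_weylDelta_mul_le` with `R w := H_w(h)` (§3 `norm_apply_evalPlace_le_localHeight`, ★ `GLn.one_le_localHeight`), `k := ⌈2 re z⌉₊ + n`, `r := re z`,
and `‖2‖_w^{−n k} ≤ N𝔭_w^{n k t_w}` (§3 `exists_dyadic_exponent`); on `S₀`: `hbad`; the two exponent systems are added. [cite: KudlaRallis1994, §2] [cite: Kudla1994, §3] [cite: HarrisKudlaSweet1996, §1 (1.15)] [cite: Casselman1980, §3] [cite: Shimura1997, §18.4 Prop. 18.14] [cite: BorelJacquet1979, §1.2] -/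
theorem hsup_of_height_of_bad [NeZero n] (T₀ : Finset (HeightOneSpectrum (𝓞 (Fp L))))
    {S₀ : Finset (HeightOneSpectrum (𝓞 (Fp L)))} {χ : HeckeCharacter L} (hχu : χ.IsUnitary)
    (hχS₀ : ∀ v, v ∉ S₀ → ∀ w : UnitaryGroup.PlacesOver L v, χ.IsUnramifiedAt w.1)
    (𝒦 : IwasawaDatum L e dV hdV dW hdW) (s₀ : ℂ) {m : ℕ}
    (b : Fin m → (v : HeightOneSpectrum (𝓞 (Fp L))) → (UnitaryGroup.localPi L (IsCMField.complexConj L) (n + n) (hermD L e dV hdV dW hdW) v → ℂ))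
    (FvT : Fin m → ∀ (S : skewMatrices ((IsCMField.complexConj L : L ≃ₐ[Fp L] L) : L →+* L) ((gramR L e dV hdV dW hdW).map (algebraMap (Fp L) L)))
      (h : HA L e dV hdV dW hdW) (v : (kindWFinset L e dV hdV dW hdW T₀ (S : Matrix (Fin n) (Fin n) L) h)), ℂ → UnitaryGroup.localPi L (IsCMField.complexConj L) (n + n) (hermD L e dV hdV dW hdW) v.1 → ℂ)
    (hread : ∀ (j : Fin m) (S : skewMatrices ((IsCMField.complexConj L : L ≃ₐ[Fp L] L) : L →+* L) ((gramR L e dV hdV dW hdW).map (algebraMap (Fp L) L)))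
      (h : HA L e dV hdV dW hdW) (v : (kindWFinset L e dV hdV dW hdW T₀ (S : Matrix (Fin n) (Fin n) L) h)) (s : ℂ) (y : UnitaryGroup.localPi L (IsCMField.complexConj L) (n + n) (hermD L e dV hdV dW hdW) v.1),
      FvT j S h v s y = if v.1 ∈ S₀ then ((modDelta L e dV hdV dW hdW (𝒦.pPart (locToAdelic L e dV hdV dW hdW v.1 y)) : ℝ) : ℂ) ^ (2 * (s - s₀)) * b j v.1 y else LambdaLoc L e dV hdV dW hdW v.1 χ s y)
    (π : ∀ v : HeightOneSpectrum (𝓞 (Fp L)), v.adicCompletion (Fp L))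
    (Tb : Finset (HeightOneSpectrum (𝓞 L)))
    (hbad : ∀ z : ℂ, 0 < z.re → ∃ (r : ℝ) (k₁ : ℕ) (β : HeightOneSpectrum (𝓞 L) → ℕ), 0 < r ∧ (∀ w ∉ Tb, β w = 0) ∧ ∀ (j : Fin m) (S : skewMatrices ((IsCMField.complexConj L : L ≃ₐ[Fp L] L) : L →+* L) ((gramR L e dV hdV dW hdW).map (algebraMap (Fp L) L))) (s : ℂ),
      dist s z < r → ∀ (h : HA L e dV hdV dW hdW) (v : (kindWFinset L e dV hdV dW hdW T₀ (S : Matrix (Fin n) (Fin n) L) h)), v.1 ∈ S₀ → ∀ (y : ↥(unipDeltaLoc L e dV hdV dW hdW v.1)), ‖FvT j S h v s (UnitaryGroup.evalPlace (Fp L) L (IsCMField.complexConj L) (n + n) (hermD L e dV hdV dW hdW) v.1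
              (UnitaryGroup.finPart (Fp L) L (IsCMField.complexConj L) (n + n) (hermD L e dV hdV dW hdW) (weylDelta L e dV hdV dW hdW)) * ((y : ↥(unipDeltaLoc L e dV hdV dW hdW v.1)) : UnitaryGroup.localPi L (IsCMField.complexConj L) (n + n) (hermD L e dV hdV dW hdW) v.1) *
            UnitaryGroup.evalPlace (Fp L) L (IsCMField.complexConj L) (n + n) (hermD L e dV hdV dW hdW) v.1 (UnitaryGroup.finPart (Fp L) L (IsCMField.complexConj L) (n + n) (hermD L e dV hdV dW hdW) h))‖ ≤
          ∏ w : UnitaryGroup.PlacesOver L v.1, ((Ideal.absNorm w.1.asIdeal : ℕ) : ℝ) ^ β w.1 * (GLn.localHeight (n + n) L w.1 (h : GL (Fin (n + n)) (AdeleRing (𝓞 L) L)) : ℝ) ^ k₁) :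
    ∃ (b₁ : ℕ) (Tβ : Finset (HeightOneSpectrum (𝓞 L))),
    ∀ z : ℂ, 0 < z.re → ∃ (r : ℝ) (k₁ : ℕ) (β : HeightOneSpectrum (𝓞 L) → ℕ), 0 < r ∧ (∀ w ∉ Tβ, β w = 0) ∧ ∀ (j : Fin m) (S : skewMatrices ((IsCMField.complexConj L : L ≃ₐ[Fp L] L) : L →+* L) ((gramR L e dV hdV dW hdW).map (algebraMap (Fp L) L))) (s : ℂ),
      dist s z < r → ∀ (h : HA L e dV hdV dW hdW) (v : (kindWFinset L e dV hdV dW hdW T₀ (S : Matrix (Fin n) (Fin n) L) h)) (a : ℕ)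
        (y : ↥(unipDeltaLoc L e dV hdV dW hdW v.1)), y ∈ kindWLocalBall L e dV hdV dW hdW v.1 (π v.1) (-(a : ℤ)) → ‖FvT j S h v s (UnitaryGroup.evalPlace (Fp L) L (IsCMField.complexConj L) (n + n) (hermD L e dV hdV dW hdW) v.1
              (UnitaryGroup.finPart (Fp L) L (IsCMField.complexConj L) (n + n) (hermD L e dV hdV dW hdW) (weylDelta L e dV hdV dW hdW)) * ((y : ↥(unipDeltaLoc L e dV hdV dW hdW v.1)) : UnitaryGroup.localPi L (IsCMField.complexConj L) (n + n) (hermD L e dV hdV dW hdW) v.1) *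
            UnitaryGroup.evalPlace (Fp L) L (IsCMField.complexConj L) (n + n) (hermD L e dV hdV dW hdW) v.1 (UnitaryGroup.finPart (Fp L) L (IsCMField.complexConj L) (n + n) (hermD L e dV hdV dW hdW) h))‖ ≤
          (∏ w : UnitaryGroup.PlacesOver L v.1, ((Ideal.absNorm w.1.asIdeal : ℕ) : ℝ) ^ β w.1 * (GLn.localHeight (n + n) L w.1 (h : GL (Fin (n + n)) (AdeleRing (𝓞 L) L)) : ℝ) ^ k₁) * ((Ideal.absNorm v.1.asIdeal : ℕ) : ℝ) ^ (b₁ * a) := by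
  haveI : NeZero (n + n) := ⟨by have := NeZero.ne n; omega⟩
  -- the dyadic exponents `t` and the dyadic set `T₂`
  choose t ht using exists_dyadic_exponent L
  refine ⟨0, Tb ∪ (Ideal.finite_factors (I := Ideal.span {(2 : 𝓞 L)}) (by simp)).toFinset, fun z hz => ?_⟩
  obtain ⟨rb, kb, βb, hrb, hβb, hB⟩ := hbad z hz
  -- the good-place exponent `k`: `2 re s + n ≤ 2 k` on the disc of radius `re z`
  refine ⟨min rb z.re, kb + n * (⌈2 * z.re⌉₊ + n), fun w => βb w + t w * (n * (⌈2 * z.re⌉₊ + n)), lt_min hrb hz, fun w hw => ?_, ?_⟩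
  · rw [Finset.notMem_union] at hw
    show βb w + t w * (n * (⌈2 * z.re⌉₊ + n)) = 0
    rw [hβb w hw.1, (ht w).2 (norm_two_eq_one_of_not_mem L hw.2), zero_mul, add_zero]
  intro j S s hs h v a y _hy
  rw [zero_mul, pow_zero, mul_one]
  have hN1 : ∀ w : UnitaryGroup.PlacesOver L v.1, (1 : ℝ) ≤ ((Ideal.absNorm w.1.asIdeal : ℕ) : ℝ) := fun w => by
    exact_mod_cast Nat.one_le_iff_ne_zero.2 fun h0 => w.1.ne_bot (Ideal.absNorm_eq_zero_iff.1 h0)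
  have hH1 : ∀ w : UnitaryGroup.PlacesOver L v.1, (1 : ℝ) ≤ (GLn.localHeight (n + n) L w.1 (h : GL (Fin (n + n)) (AdeleRing (𝓞 L) L)) : ℝ) := fun w => by
    exact_mod_cast GLn.one_le_localHeight (n := n + n) (K := L) w.1 (h : GL (Fin (n + n)) (AdeleRing (𝓞 L) L))
  by_cases hv : v.1 ∈ S₀
  · -- the `S₀`-face: `hbad`, then enlarge the exponents
    refine (hB j S s (lt_of_lt_of_le hs (min_le_left _ _)) h v hv y).trans (Finset.prod_le_prod (fun w _ => ?_) fun w _ => ?_)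
    · exact mul_nonneg (pow_nonneg (zero_le_one.trans (hN1 w)) _) (pow_nonneg (zero_le_one.trans (hH1 w)) _)
    · exact mul_le_mul (pow_le_pow_right₀ (hN1 w) (Nat.le_add_right _ _)) (pow_le_pow_right₀ (hH1 w) (Nat.le_add_right _ _)) (pow_nonneg (zero_le_one.trans (hH1 w)) _) (pow_nonneg (zero_le_one.trans (hN1 w)) _)
  · -- off `S₀`: the reading is `Λ_{s,v}`, bounded by §2 uniformly in `y`
    rw [hread, if_neg hv]
    have hsre : 0 < s.re ∧ s.re ≤ 2 * z.re := by
      have h1 : |s.re - z.re| ≤ dist s z := by rw [Complex.dist_eq, ← Complex.sub_re]; exact Complex.abs_re_le_norm _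
      have h2 : dist s z < z.re := lt_of_lt_of_le hs (min_le_right _ _)
      have h3 := (abs_lt.1 (lt_of_le_of_lt h1 h2))
      constructor <;> linarith [h3.1, h3.2]
    have hs0 : 0 ≤ 2 * s.re + (n : ℝ) := by have : (0 : ℝ) ≤ n := Nat.cast_nonneg n; linarith [hsre.1]
    have hk : 2 * s.re + (n : ℝ) ≤ 2 * ((⌈2 * z.re⌉₊ + n : ℕ) : ℝ) := by
      have hc : 2 * z.re ≤ (⌈2 * z.re⌉₊ : ℝ) := Nat.le_ceil _
      have : (0 : ℝ) ≤ n := Nat.cast_nonneg n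
      push_cast; linarith [hsre.2]
    refine (norm_lambdaLoc_weylDelta_mul_le L e dV hdV dW hdW v.1 hχu (hχS₀ v.1 hv) hs0 hk y.2 _ (R := fun w => (GLn.localHeight (n + n) L w.1 (h : GL (Fin (n + n)) (AdeleRing (𝓞 L) L)) : ℝ)) hH1
      (fun w a b => norm_apply_evalPlace_le_localHeight L e dV hdV dW hdW h w a b)).trans (Finset.prod_le_prod (fun w _ => ?_) fun w _ => ?_)
    · exact pow_nonneg (mul_nonneg (inv_nonneg.2 (norm_nonneg _)) (zero_le_one.trans (hH1 w))) _
    · exact mul_pow_le_pow_mul_pow (hN1 w) (hH1 w) (inv_nonneg.2 (norm_nonneg _)) (ht w.1).1 (by nlinarith [Nat.zero_le (βb w.1)]) (Nat.le_add_left _ _)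

end Summit.HodgeConjecture.HodgeConjecture.Cruxes.HLiu418.K2LiuKindWFiniteSectionSupBound

end
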